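import Mathlib
import Summits.Ventures.PercRepro.TriangleCapSubBandBottom

/-!
# PercRepro — EVERY SUB-BAND IS AN INTERVAL: THE TWO STAIRCASES (p3, gen 52; part 263)

THE INTERIOR WITNESS (`interiorWitness`): the `(t − u)`-star at the non-neighbour `1` with `e` ends at non-leaves,
plus `u` off-edges with left ends `1 + lfRR k v` over the carriers `2, …, k + 1` (`v` of them at the carrier `2`, the
rest round-robin — THE LEFT STAIRCASE of part 238) and right ends at the first `c` leaves of the star then at fresh
leaves (THE RIGHT STAIRCASE: `c` shared leaves, `coll rf = 2 c`).  Its value is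
`2 j = 2 B + 2 e + (u (u + 1) − coll u (lfRR k v)) − 2 c`, `B = u (t − u − 1)`; the left staircase moves in steps
`≤ 2 u`, the right one fills `2 c`, `c ≤ u`, downward and the non-leaf ends `2 e`, `e ≤ ℓ − 1 − k`, upward, so every
even `2 m ≤ u (u + 1) − coll u (lfRR k 0) + 2 (ℓ − 1 − k)` is reached (`cover_two_sided`).  Hence
(`subband_interval`) every `j` from the bottom `B` to `B + (u (u + 1) − coll u (lfRR k 0))/2 + ℓ − 1 − k` is attained,
for every `1 ≤ k ≤ ℓ − 1`, `u ≤ t − u`, `2 t ≤ s`; with `k = ℓ − 1 ≤ u` the top is the sharp sub-band bound of part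
257 (`subband_interval_exact`): **THE SUB-BAND `u` IS EXACTLY THE INTERVAL `[B, B + W(u, ℓ)]`** — and with `k = u ≤ ℓ − 1`
the top `B + C(u, 2) + ℓ − 1` (`subband_interval_small`).  Axioms: standard.
-/

namespace PercRepro

namespace TriangleCap

namespace C047

open Finset

/-- **THE TWO-SIDED COVERING LEMMA:** `E u = 2 u`, `E` even, `E v ≤ E (v + 1) + 2 u`: every even `2 m ≤ E 0 + 2 c′` is
`2 e + E v − 2 c` with `v ≤ u`, `e ≤ c′`, `c ≤ u`. -/
theorem cover_two_sided (u c' : ℕ) (E : ℕ → ℕ) (hEu : E u = 2 * u) (hEeven : ∀ v, Even (E v))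
    (hstep : ∀ v, v < u → E v ≤ E (v + 1) + 2 * u) :
    ∀ k, k ≤ u → ∀ m, 2 * m ≤ E (u - k) + 2 * c' →
      ∃ v, u - k ≤ v ∧ v ≤ u ∧ ∃ e, e ≤ c' ∧ ∃ c, c ≤ u ∧ 2 * m + 2 * c = 2 * e + E v := by
  intro k
  induction k with
  | zero =>
    intro _ m hm
    rw [Nat.sub_zero, hEu] at hm
    rcases Nat.lt_or_ge m u with h | h
    · exact ⟨u, le_rfl, le_rfl, 0, Nat.zero_le _, u - m, by omega, by rw [hEu]; omega⟩
    · exact ⟨u, le_rfl, le_rfl, m - u, by omega, 0, Nat.zero_le _, by rw [hEu]; omega⟩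
  | succ k ih =>
    intro hk m hm
    by_cases hcase : 2 * m ≤ E (u - k) + 2 * c'
    · obtain ⟨v, h1, h2, e, he, c, hc, hmc⟩ := ih (by omega) m hcase
      exact ⟨v, by omega, h2, e, he, c, hc, hmc⟩
    · have hstep' := hstep (u - (k + 1)) (by omega)
      have e1 : u - (k + 1) + 1 = u - k := by omega
      rw [e1] at hstep'
      obtain ⟨x, hx⟩ := hEeven (u - (k + 1))
      refine ⟨u - (k + 1), le_rfl, by omega, c', le_rfl, (E (u - (k + 1)) + 2 * c' - 2 * m) / 2, ?_, ?_⟩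
      · omega
      · omega

/-- The left ends of the interior witness: `1` on the star, `1 + lfRR k v` shifted on the off-edges. -/
def lfInt (t u k v i : ℕ) : ℕ := if i < t - u then 1 else 1 + lfRR k v (i - (t - u))

/-- `coll` of the interior witness's left ends. -/
theorem coll_lfInt (t u k v : ℕ) (hu : u ≤ t) (hk : 1 ≤ k) :
    coll t (lfInt t u k v) = (t - u) * (t - u - 1) + coll u (lfRR k v) := by
  have e : t = (t - u) + u := by omega
  have h := coll_concat (t - u) u (fun _ => 1) (fun i => 1 + lfRR k v i) (fun i _ i' _ => by
    have := lfRR_bounds k v i' hk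
    omega)
  rw [coll_add_const] at h
  have hc : coll (t - u) (fun _ => 1) = (t - u) * (t - u - 1) := by
    rw [coll_congr (t - u) (fun _ => 1) (lfRR k (t - u)) (fun i hi => by unfold lfRR; rw [if_pos hi]),
      coll_lfRR_top]
  rw [← e, hc] at h
  exact h

/-- The right ends of the interior witness: `e` non-leaves and the leaves `k + 2, …` for the star; the first `c`
leaves again, then fresh leaves, for the off-edges. -/
def rfInt (s t u k e c i : ℕ) : ℕ :=
  if i < e then k + 2 + (s - t) + i
  else if i < t - u then k + 2 + (i - e)
  else if i < t - u + c then k + 2 + (i - (t - u))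
  else k + 2 + (t - u - e) + (i - (t - u))

/-- The regions of the interior witness's right ends. -/
theorem rfInt_cases (s t u k e c i : ℕ) (hi : i < t) :
    (i < e ∧ rfInt s t u k e c i = k + 2 + (s - t) + i) ∨
    (e ≤ i ∧ i < t - u ∧ rfInt s t u k e c i = k + 2 + (i - e)) ∨
    (t - u ≤ i ∧ i < t - u + c ∧ rfInt s t u k e c i = k + 2 + (i - (t - u))) ∨
    (t - u + c ≤ i ∧ i < t ∧ rfInt s t u k e c i = k + 2 + (t - u - e) + (i - (t - u))) := by
  unfold rfInt
  by_cases h1 : i < e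
  · left
    exact ⟨h1, by rw [if_pos h1]⟩
  · by_cases h2 : i < t - u
    · right; left
      exact ⟨by omega, h2, by rw [if_neg h1, if_pos h2]⟩
    · by_cases h3 : i < t - u + c
      · right; right; left
        exact ⟨by omega, h3, by rw [if_neg h1, if_neg h2, if_pos h3]⟩
      · right; right; right
        exact ⟨by omega, hi, by rw [if_neg h1, if_neg h2, if_neg h3]⟩

/-- `coll` of the interior witness's right ends: `2 c` (the shared leaves). -/
theorem coll_rfInt (s t u k e c : ℕ) (hs : 2 * t ≤ s) (hut : u ≤ t) (hc : c ≤ u) (hce : c + e ≤ t - u) :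
    coll t (rfInt s t u k e c) = 2 * c := by
  unfold coll
  have hset : (range t).offDiag.filter (fun p : ℕ × ℕ => rfInt s t u k e c p.1 = rfInt s t u k e c p.2) =
      (range c).image (fun i => (e + i, t - u + i)) ∪ (range c).image (fun i => (t - u + i, e + i)) := by
    ext ⟨i, i'⟩
    simp only [mem_filter, mem_offDiag, mem_range, mem_union, mem_image, Prod.mk.injEq]
    constructor
    · rintro ⟨⟨h1, h2, h3⟩, h4⟩
      rcases rfInt_cases s t u k e c i h1 with ⟨hi1, hv⟩ | ⟨hi1, hi2, hv⟩ | ⟨hi1, hi2, hv⟩ | ⟨hi1, hi2, hv⟩ <;>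
        rcases rfInt_cases s t u k e c i' h2 with ⟨hj1, hw⟩ | ⟨hj1, hj2, hw⟩ | ⟨hj1, hj2, hw⟩ | ⟨hj1, hj2, hw⟩ <;>
        rw [hv, hw] at h4 <;>
        first
          | omega
          | exact Or.inl ⟨i - e, by omega, by omega, by omega⟩
          | exact Or.inr ⟨i' - e, by omega, by omega, by omega⟩
    · rintro (⟨x, hx, rfl, rfl⟩ | ⟨x, hx, rfl, rfl⟩)
      · refine ⟨⟨by omega, by omega, by omega⟩, ?_⟩
        unfold rfInt
        rw [if_neg (by omega), if_pos (by omega), if_neg (by omega), if_neg (by omega), if_pos (by omega)]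
        omega
      · refine ⟨⟨by omega, by omega, by omega⟩, ?_⟩
        unfold rfInt
        rw [if_neg (by omega), if_neg (by omega), if_pos (by omega), if_neg (by omega), if_pos (by omega)]
        omega
  rw [hset, card_union_of_disjoint, card_image_of_injective, card_image_of_injective, card_range]
  · ring
  · intro x y h
    rw [Prod.mk.injEq] at h
    omega
  · intro x y h
    rw [Prod.mk.injEq] at h
    omega
  · rw [disjoint_left]
    intro p hp hp'
    rw [mem_image] at hp hp'
    obtain ⟨x, hx, rfl⟩ := hp
    obtain ⟨y, hy, hxy⟩ := hp'
    rw [Prod.mk.injEq] at hxy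
    rw [mem_range] at hx hy
    omega

/-- **THE INTERIOR WITNESS:** for `1 ≤ k`, `e + k + 1 ≤ ℓ`, `1 ≤ u`, `2 u ≤ t`, `c ≤ u`, `c + e ≤ t − u`, `2 t ≤ s`
and any `v`, the value `2 j = 2 e + 2 u (t − u − 1) + u (u + 1) − coll u (lfRR k v) − 2 c` is attained on
`ℓ + 1 + (s − t)` vertices. -/
theorem interiorWitness (ℓ s t u k v e c : ℕ) (hk : 1 ≤ k) (he : e + k + 1 ≤ ℓ) (hu : 1 ≤ u) (hut : 2 * u ≤ t)
    (hc : c ≤ u) (hce : c + e ≤ t - u) (hs : 2 * t ≤ s) :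
    ∃ (H : SimpleGraph (Fin (ℓ + 1 + (s - t)))) (_ : DecidableRel H.Adj), H.CliqueFree 3 ∧
      H.edgeFinset.card = s ∧ (∃ w, deg H w + t = s) ∧
      ∑ v', deg H v' * deg H v' + 2 * (t * (s - t - 1)) +
        (2 * e + 2 * (u * (t - u - 1)) + u * (u + 1) - coll u (lfRR k v) - 2 * c) = s * (s + 1) := by
  set n := ℓ + 1 + (s - t) with hn
  have hn0 : 0 < n := by omega
  have hg : GoodEnds n (k + 2) t (lfInt t u k v) (rfInt s t u k e c) := by
    refine ⟨fun i hi => ?_, fun i hi => ?_, fun i i' hi hi' h1 h2 => ?_⟩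
    · unfold lfInt
      have := lfRR_bounds k v (i - (t - u)) hk
      split_ifs <;> omega
    · rcases rfInt_cases s t u k e c i hi with ⟨hi1, hv⟩ | ⟨hi1, hi2, hv⟩ | ⟨hi1, hi2, hv⟩ |
          ⟨hi1, hi2, hv⟩ <;> rw [hv] <;> omega
    · have hb1 := lfRR_bounds k v (i - (t - u)) hk
      have hb2 := lfRR_bounds k v (i' - (t - u)) hk
      unfold lfInt at h1
      rcases rfInt_cases s t u k e c i hi with ⟨hi1, hv⟩ | ⟨hi1, hi2, hv⟩ | ⟨hi1, hi2, hv⟩ |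
          ⟨hi1, hi2, hv⟩ <;>
        rcases rfInt_cases s t u k e c i' hi' with ⟨hj1, hw⟩ | ⟨hj1, hj2, hw⟩ | ⟨hj1, hj2, hw⟩ |
          ⟨hj1, hj2, hw⟩ <;>
        rw [hv, hw] at h2 <;> split_ifs at h1 <;> omega
  have hval := genWitness_missing_value n (k + 2) s t hn0 (lfInt t u k v) (rfInt s t u k e c) hg (by omega)
    (by omega) (by omega) (by omega)
  have hatt : ((range t).filter (fun i => rfInt s t u k e c i < k + 2 + (s - t))).card = t - e := by
    have : (range t).filter (fun i => rfInt s t u k e c i < k + 2 + (s - t)) = Ico e t := by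
      ext i
      simp only [mem_filter, mem_range, mem_Ico]
      constructor
      · rintro ⟨hi, hlt⟩
        rcases rfInt_cases s t u k e c i hi with ⟨hi1, hv⟩ | ⟨hi1, hi2, hv⟩ | ⟨hi1, hi2, hv⟩ |
            ⟨hi1, hi2, hv⟩ <;> rw [hv] at hlt <;> omega
      · rintro ⟨hi1, hi2⟩
        refine ⟨hi2, ?_⟩
        rcases rfInt_cases s t u k e c i hi2 with ⟨hi1', hv⟩ | ⟨hi1', hi2', hv⟩ | ⟨hi1', hi2', hv⟩ |
            ⟨hi1', hi2', hv⟩ <;> rw [hv] <;> omega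
    rw [this, Nat.card_Ico]
  rw [hatt, coll_rfInt s t u k e c hs (by omega) hc hce, coll_lfInt t u k v (by omega) hk] at hval
  refine ⟨_, inferInstance, cliqueFree_of_bipSub _ _ (bipSub_missingGraph _ _),
    card_edges_missingGraph_genWitness n (k + 2) s t hn0 (lfInt t u k v) (rfInt s t u k e c) hg (by omega)
      (by omega) (by omega),
    ⟨fin' n hn0 0, by
      rw [deg_missingGraph_genWitness_zero n (k + 2) s t hn0 (lfInt t u k v) (rfInt s t u k e c) hg (by omega)
        (by omega)]
      omega⟩, ?_⟩
  have e1 : t - (t - e) = e := by omega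
  have hid := subband_identity t u (by omega)
  have hcoll := coll_le u (lfRR k v)
  have hu1 : u * (u - 1) ≤ u * (u + 1) := Nat.mul_le_mul_left u (by omega)
  have e2 : t * (t - 1) - ((t - u) * (t - u - 1) + coll u (lfRR k v) + 2 * c) =
      2 * (u * (t - u - 1)) + u * (u + 1) - coll u (lfRR k v) - 2 * c := by omega
  rw [e1, e2] at hval
  have e3 : 2 * e + 2 * (u * (t - u - 1)) + u * (u + 1) - coll u (lfRR k v) - 2 * c =
      2 * e + (2 * (u * (t - u - 1)) + u * (u + 1) - coll u (lfRR k v) - 2 * c) := by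
    have e4 : u * (u + 1) = u * (u - 1) + 2 * u := by
      obtain ⟨u', rfl⟩ : ∃ u', u = u' + 1 := ⟨u - 1, by omega⟩
      rw [Nat.add_sub_cancel]
      ring
    omega
  rw [e3]
  exact hval

/-- **EVERY SUB-BAND IS AN INTERVAL (`k` carriers):** for `1 ≤ k`, `k + 1 ≤ ℓ`, `1 ≤ u`, `2 u ≤ t`,
`2 u + ℓ ≤ t + k + 1` (room for the shared leaves and the non-leaf star ends), `2 t ≤ s`, every `j` with
`u (t − u − 1) ≤ j` and
`2 j ≤ 2 u (t − u − 1) + (u (u + 1) − coll u (lfRR k 0)) + 2 (ℓ − 1 − k)` is attained on `ℓ + 1 + (s − t)` vertices. -/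
theorem subband_interval (ℓ s t u k j : ℕ) (hk : 1 ≤ k) (hkℓ : k + 1 ≤ ℓ) (hu : 1 ≤ u)
    (hut : 2 * u ≤ t) (hℓt : 2 * u + ℓ ≤ t + k + 1) (hs : 2 * t ≤ s) (hj1 : u * (t - u - 1) ≤ j)
    (hj2 : 2 * j ≤ 2 * (u * (t - u - 1)) + (u * (u + 1) - coll u (lfRR k 0)) + 2 * (ℓ - 1 - k)) :
    ∃ (H : SimpleGraph (Fin (ℓ + 1 + (s - t)))) (_ : DecidableRel H.Adj), H.CliqueFree 3 ∧
      H.edgeFinset.card = s ∧ (∃ w, deg H w + t = s) ∧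
      ∑ v, deg H v * deg H v + 2 * (t * (s - t - 1)) + 2 * j = s * (s + 1) := by
  obtain ⟨m, rfl⟩ : ∃ m, j = u * (t - u - 1) + m := ⟨j - u * (t - u - 1), by omega⟩
  have hle : ∀ v, coll u (lfRR k v) ≤ u * (u - 1) := fun v => coll_le u _
  have hu1 : u * (u - 1) + 2 * u = u * (u + 1) := by
    obtain ⟨u', rfl⟩ : ∃ u', u = u' + 1 := ⟨u - 1, by omega⟩
    rw [Nat.add_sub_cancel]
    ring
  have hcover := cover_two_sided u (ℓ - 1 - k) (fun v => u * (u + 1) - coll u (lfRR k v))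
    (by show u * (u + 1) - coll u (lfRR k u) = 2 * u; rw [coll_lfRR_top]; omega)
    (fun v => by
      obtain ⟨x, hx⟩ := coll_even u (lfRR k v)
      obtain ⟨d, hd⟩ := Nat.even_mul_succ_self u
      have := hle v
      exact ⟨d - x, by omega⟩)
    (fun v _ => by
      have h1 := coll_le_coll_add_of_eq_off u (lfRR k (v + 1)) (lfRR k v) v (fun i _ hi => lfRR_eq_off k v i hi)
      have := hle v
      have := hle (v + 1)
      show u * (u + 1) - coll u (lfRR k v) ≤ u * (u + 1) - coll u (lfRR k (v + 1)) + 2 * u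
      omega)
    u le_rfl m (by
      show 2 * m ≤ u * (u + 1) - coll u (lfRR k (u - u)) + 2 * (ℓ - 1 - k)
      rw [Nat.sub_self]
      have := hle 0
      omega)
  obtain ⟨v, -, -, e, he, c, hc, hmc⟩ := hcover
  have hw := interiorWitness ℓ s t u k v e c hk (by omega) hu hut hc (by omega) hs
  have hv := hle v
  have e5 : 2 * e + 2 * (u * (t - u - 1)) + u * (u + 1) - coll u (lfRR k v) - 2 * c =
      2 * (u * (t - u - 1) + m) := by omega
  rw [e5] at hw
  exact hw

/-- **THE SUB-BAND `u` IS EXACTLY AN INTERVAL (`ℓ − 1 ≤ u`):** for `2 ≤ ℓ`, `ℓ ≤ u + 1`, `2 u ≤ t`, `2 t ≤ s`, with `q = ⌊u / (ℓ − 1)⌋`: a value `j` is attained by a graph with a non-neighbour of off-degree `t − u`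
only if `u (t − u − 1) ≤ j` and `2 j + 2 q u ≤ 2 u (t − u − 1) + u (u + 1) + (ℓ − 1) q (q + 1)`, and EVERY such `j`
is attained. -/
theorem subband_interval_exact (ℓ s t u : ℕ) (hℓ : 2 ≤ ℓ) (hℓu : ℓ ≤ u + 1) (hut : 2 * u ≤ t) (hs : 2 * t ≤ s) :
    (∀ (H : SimpleGraph (Fin (ℓ + 1 + (s - t)))) [DecidableRel H.Adj], H.CliqueFree 3 →
      H.edgeFinset.card = s → ∀ w, deg H w + t = s → ∀ j,
      ∑ v, deg H v * deg H v + 2 * (t * (s - t - 1)) + 2 * j = s * (s + 1) →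
      ∀ x, offDeg H w x + u = t → ¬ H.Adj w x →
        u * (t - u - 1) ≤ j ∧
          2 * j + 2 * ((u / (ℓ - 1)) * u) ≤ 2 * (u * (t - u - 1)) + u * (u + 1) +
            (ℓ - 1) * ((u / (ℓ - 1)) * (u / (ℓ - 1) + 1))) ∧
    ∀ j, u * (t - u - 1) ≤ j →
      2 * j + 2 * ((u / (ℓ - 1)) * u) ≤ 2 * (u * (t - u - 1)) + u * (u + 1) +
        (ℓ - 1) * ((u / (ℓ - 1)) * (u / (ℓ - 1) + 1)) →
      ∃ (H : SimpleGraph (Fin (ℓ + 1 + (s - t)))) (_ : DecidableRel H.Adj), H.CliqueFree 3 ∧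
        H.edgeFinset.card = s ∧ (∃ w, deg H w + t = s) ∧
        ∑ v, deg H v * deg H v + 2 * (t * (s - t - 1)) + 2 * j = s * (s + 1) := by
  have hu : 1 ≤ u := by omega
  refine ⟨fun H _ hfree hs' w hw j hj x hx hxw => (subband_ends ℓ s t u hℓ hℓu hu hut hs).2.2 H hfree hs' w hw j hj
    x hx hxw, fun j hj1 hj2 => ?_⟩
  apply subband_interval ℓ s t u (ℓ - 1) j (by omega) (by omega) hu hut (by omega) hs hj1
  rw [coll_lfRR_zero (ℓ - 1) u (by omega)]
  have hth := row_threshold (ℓ - 1) u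
  rw [mul_assoc] at hth
  have hle : (ℓ - 1) * ((u / (ℓ - 1)) * (u / (ℓ - 1) - 1)) + 2 * ((u % (ℓ - 1)) * (u / (ℓ - 1))) ≤ u * (u - 1) := by
    rw [← coll_lfRR_zero (ℓ - 1) u (by omega)]
    exact coll_le u _
  have hu1 : u * (u - 1) ≤ u * (u + 1) := Nat.mul_le_mul_left u (by omega)
  have e : ℓ - 1 - (ℓ - 1) = 0 := Nat.sub_self _
  rw [e]
  omega

/-- **THE SUB-BAND `u` IS EXACTLY AN INTERVAL (`u ≤ ℓ − 1`):** for `1 ≤ u`, `u + 1 ≤ ℓ`, `2 u ≤ t`, `ℓ + u ≤ t + 1`,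
`2 t ≤ s`: every `j` with `u (t − u − 1) ≤ j` and `2 j ≤ 2 u (t − u − 1) + u (u + 1) − 2 u + 2 (ℓ − 1)` (the sub-band
bound at `q = 1`) is attained. -/
theorem subband_interval_small (ℓ s t u j : ℕ) (hu : 1 ≤ u) (hℓu : u + 1 ≤ ℓ) (hut : 2 * u ≤ t) (hℓt : ℓ + u ≤ t + 1)
    (hs : 2 * t ≤ s) (hj1 : u * (t - u - 1) ≤ j)
    (hj2 : 2 * j + 2 * u ≤ 2 * (u * (t - u - 1)) + u * (u + 1) + 2 * (ℓ - 1)) :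
    ∃ (H : SimpleGraph (Fin (ℓ + 1 + (s - t)))) (_ : DecidableRel H.Adj), H.CliqueFree 3 ∧
      H.edgeFinset.card = s ∧ (∃ w, deg H w + t = s) ∧
      ∑ v, deg H v * deg H v + 2 * (t * (s - t - 1)) + 2 * j = s * (s + 1) := by
  apply subband_interval ℓ s t u u j hu hℓu hu hut (by omega) hs hj1
  rw [coll_lfRR_zero u u hu, Nat.div_self hu, Nat.mod_self]
  simp only [Nat.sub_self, mul_zero, zero_mul, add_zero, Nat.sub_zero]
  omega

end C047

end TriangleCap

end PercRepro
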